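import Summits.BirchSwinnertonDyer.BirchSwinnertonDyer.Theses.SignedLowerHalves
import Summits.BirchSwinnertonDyer.BirchSwinnertonDyer.Theorems.SignedLowerHalvesSmallImageMuZeroOneSignCone
import Summits.BirchSwinnertonDyer.BirchSwinnertonDyer.Theorems.SignedLowerHalvesKobayashiMainConjectureSmallImageTeichSpanHecke
import Summits.BirchSwinnertonDyer.Rank1Residual.GaloisImage.NonsplitCartanDictionary
import Summits.BirchSwinnertonDyer.BirchSwinnertonDyer.Theorems.SignedLowerHalvesSmallImageMuZeroOneSignEvenBranch
import HarnessLib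

/-!
# Route `SignedLowerHalves` (K3), crux M `SmallImageMuZeroOneSign` (item stmt-BirchSwinnertonDyer-23600) BY NAME, modulo named `Prop`s:
# M ⟸ print ∧ retired 23117; M ⟸ print ∧ Conjecture B⁰_ss; M at `p = 3` reading; M ⟺ 23117 modulo L ∧ print
# (cell `bsd-ssimc`, LEAD seat `cruxlead-stmt-BirchSwinnertonDyer-23600` gen 0, line `birth_mu` v2; `--supports 23600 --as helper`)

HONEST FRAMING.  Crux M is NOT proved: every theorem below that concludes the route decl `SmallImageMuZeroOneSign` carries
UNDISCHARGED hypotheses — five PUBLISHED facts by name (`hCK` Kobayashi 2003 Thm. 6.2/6.3/7.3, `h12` Thm. 1.2, `h5`/`h3` the period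
units, `hmodP` modularity with parametrisation) and ONE open statement by name: either retired item stmt-BirchSwinnertonDyer-23117
`SmallImageOneSignUnitContent` (the one-sign analytic `μ`-rider at `p ≥ 5` on the residually `K`-dihedral class) or the tree's
Conjecture B⁰_ss `SmallImageTeichSpanHecke.TeichSpanGenModHeckeAll` (which implies it, slh-p3 g10 p-series).  The gate records these as
conditional results; the item stays OPEN.  BSD / crux 4 are not proved by any of this.

* `smallImageMuZeroOneSign_of_facts_of_oneSignUnitContent` — M ⟸ print ∧ 23117 (line `birth_mu`'s composition with its one open
  stub displayed as the retired item BY NAME; `SmallImageMuControl` §4).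
* `smallImageMuZeroOneSign_of_facts_of_teichSpanGenModHeckeAll` — M ⟸ print ∧ B⁰_ss (through
  `SmallImageTeichSpanHecke.muOneSign_ns_ge5_of_teichSpanGenModHeckeAll`).
* `smallImageOneSignUnitContent_of_lower_of_mu` — 23117 ⟸ `h5 h3` ∧ L ∧ M BY NAME (`SmallImageMuCone` (b)); with the first bullet,
  `smallImageMuZeroOneSign_iff_oneSignUnitContent_of_lower`: modulo print and child L, **M ⟺ 23117**.

References: [Kobayashi2003] Conjecture (p. 2), Thm. 1.2, Thm. 6.2–6.3, Thm. 7.3; [Pollack2003] Conj. 6.3; [PollackWeston2011] Rem. 4.2;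
[MazurTateTeitelbaum1986Invent] §I.4 (4.2), §I.10; tree `…SmallImageMuZeroOneSignMuControl` (p683375/p683745), `…SmallImageMuZeroOneSignCone`
(p684669), `…SmallImageTeichSpanHecke`.
-/

-- D-0017: single-problem summit, the namespace repeats the problem name by design.
set_option linter.dupNamespace false
set_option autoImplicit false

noncomputable section

open Literature.NumberTheory.EllipticCurves Literature.NumberTheory.EllipticCurves.ModularForms
  Literature.NumberTheory.EllipticCurves.Kobayashi2003
  Summit.BirchSwinnertonDyer.BirchSwinnertonDyer.Theses.SignedLowerHalves
  Summit.BirchSwinnertonDyer.BirchSwinnertonDyer.Theorems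

namespace Summit.BirchSwinnertonDyer.BirchSwinnertonDyer.Theorems.SmallImageMuZeroOneSignOfFacts

/-- **Crux M BY NAME ⟸ print ∧ retired item 23117 BY NAME.**  GRANTED `hCK h12 h5 h3 hmodP` and `SmallImageOneSignUnitContent`
(retired stmt-BirchSwinnertonDyer-23117: at every small-image X7 pair with `5 ≤ p`, for the conductor-level newform, SOME sign has a
signed `p`-adic `L`-function with a unit coefficient), the route decl `SmallImageMuZeroOneSign` holds.  Line `birth_mu`'s
composition (`SmallImageMuControl.smallImageMuZeroOneSign_of_facts_of_muAnOneSignGeFive`: brick at the rider's sign; `p = 3` rider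
input-free).  CONDITIONAL — the item stays open. [cite: Kobayashi2003, Conjecture (Main Conjecture) (p. 2), Thm. 1.2, Thm. 7.3 (7.21)]
[cite: Pollack2003, Conj. 6.3 (p. 548)] -/
theorem smallImageMuZeroOneSign_of_facts_of_oneSignUnitContent
    (hCK : thm62_63_73_signedColemanKato_zeta) (h12 : thm12_signedSelmerDual_finite_torsion)
    (h5 : realPeriodRat_eq_unit_mul_plusPeriod) (h3 : realPeriodRat_eq_unit_mul_plusPeriod_three)
    (hmodP : nonempty_modularParametrizationData) (h23117 : SmallImageOneSignUnitContent) :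
    SmallImageMuZeroOneSign := by
  unfold SmallImageMuZeroOneSign
  exact SmallImageMuControl.smallImageMuZeroOneSign_of_facts_of_muAnOneSignGeFive hCK h12 h5 h3 hmodP h23117

/-- **Crux M BY NAME ⟸ print ∧ Conjecture B⁰_ss BY NAME** (`SmallImageTeichSpanHecke.TeichSpanGenModHeckeAll`: Teichmüller-averaged
generation of the `p`-power winding classes modulo `T_p`, every `p ≥ 5`, every level prime to `p` — an OPEN conjecture of the cell,
stated as a closed `Prop`, which yields 23117's body by `SmallImageTeichSpanHecke.muOneSign_ns_ge5_of_teichSpanGenModHeckeAll`).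
CONDITIONAL — the item stays open. [cite: MazurTateTeitelbaum1986Invent, §I.4 (4.2), §I.10 (10.1)] [cite: PollackWeston2011, Thm. 4.1 (1), Rem. 4.2] -/
theorem smallImageMuZeroOneSign_of_facts_of_teichSpanGenModHeckeAll
    (hCK : thm62_63_73_signedColemanKato_zeta) (h12 : thm12_signedSelmerDual_finite_torsion)
    (h5 : realPeriodRat_eq_unit_mul_plusPeriod) (h3 : realPeriodRat_eq_unit_mul_plusPeriod_three)
    (hmodP : nonempty_modularParametrizationData) (hB : SmallImageTeichSpanHecke.TeichSpanGenModHeckeAll) :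
    SmallImageMuZeroOneSign := by
  unfold SmallImageMuZeroOneSign
  exact SmallImageMuControl.smallImageMuZeroOneSign_of_facts_of_muAnOneSignGeFive hCK h12 h5 h3 hmodP
    (SmallImageTeichSpanHecke.muOneSign_ns_ge5_of_teichSpanGenModHeckeAll hB)

/-- **Retired 23117 BY NAME ⟸ the period units ∧ child L BY NAME ∧ crux M BY NAME** — the route file's sentence «under child L,
M implies the analytic one-sign unit content = old child 23117», kernel-certified (`SmallImageMuCone.muAnOneSign_of_lowerBothSigns_of_muZeroOneSign`
restricted to `5 ≤ p`). [cite: Kobayashi2003, Conjecture (Main Conjecture) (p. 2)] [cite: Pollack2003, Thm. 5.6, Prop. 6.18] -/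
theorem smallImageOneSignUnitContent_of_lower_of_mu
    (h5 : realPeriodRat_eq_unit_mul_plusPeriod) (h3 : realPeriodRat_eq_unit_mul_plusPeriod_three)
    (hL : SmallImageLowerHalfBothSigns) (hM : SmallImageMuZeroOneSign) : SmallImageOneSignUnitContent := by
  intro W _ _ p _ hp5 hX hCM hap hs _ f hf
  exact SmallImageMuCone.muAnOneSign_of_lowerBothSigns_of_muZeroOneSign h5 h3 hL hM W p (by omega) hX hCM hap hs f hf

/-- **Modulo print and child L, crux M ⟺ retired 23117** (BY NAME on both sides): the `μ`-resplit's child M is the parent line's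
one-sign analytic rider in algebraic dress. [cite: Kobayashi2003, Conjecture (Main Conjecture) (p. 2)] [cite: Pollack2003, Conj. 6.3 (p. 548)] -/
theorem smallImageMuZeroOneSign_iff_oneSignUnitContent_of_lower
    (hCK : thm62_63_73_signedColemanKato_zeta) (h12 : thm12_signedSelmerDual_finite_torsion)
    (h5 : realPeriodRat_eq_unit_mul_plusPeriod) (h3 : realPeriodRat_eq_unit_mul_plusPeriod_three)
    (hmodP : nonempty_modularParametrizationData) (hL : SmallImageLowerHalfBothSigns) :
    SmallImageMuZeroOneSign ↔ SmallImageOneSignUnitContent :=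
  ⟨smallImageOneSignUnitContent_of_lower_of_mu h5 h3 hL,
    smallImageMuZeroOneSign_of_facts_of_oneSignUnitContent hCK h12 h5 h3 hmodP⟩

/-! ## §2 (appended, LEAD g0) The open stub lives at THREE primes: M BY NAME ⟸ print ∧ the one-sign rider at `p ∈ {5, 7, 11}`
∧ BDMTV 2019/2023 ∧ the non-split half of Serre uniformity (`p ≥ 19`) — reading of k3-c4's `…SmallImageCartan` on child M:
the domain is the `X_ns⁺(p)` locus, EMPTY at `13`, `17` (published) and at every `p ≥ 19` with `X_ns⁺(p)(ℚ)` CM. -/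

/-- **Crux M BY NAME from the one-sign analytic rider at the three primes `5, 7, 11` only**, GRANTED: the five prints
(`hCK h12 h5 h3 hmodP`), BDMTV 2019 Cor. 1.3 / 2023 Thm. 1.2 (`h13`, `h17`: `X_ns⁺(13)(ℚ)`, `X_ns⁺(17)(ℚ)` are CM — PUBLISHED, by
name) and the non-split-Cartan half of Serre's uniformity question for every prime `p ≥ 19` (`h19`, OPEN, expected).  The `p = 3`
rows are the input-free rider (`SmallImageMuControl` §3); at `13`, `17`, `≥ 19` the domain is EMPTY (route-independent
kernel `GaloisImage.hasNonsplitCartanModPImage_of_goodSS_of_not_surj` of k3-c4's `…SmallImageCartan`); what is left is `h5711` — «at every small-image X7 pair with `p ∈ {5, 7, 11}`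
(the non-CM `ℚ`-points of the genus-`0, 0, 1` curves `X_ns⁺(5)`, `X_ns⁺(7)`, `X_ns⁺(11)`, infinite families, good at `p`), for the
conductor-level newform SOME sign has a signed `p`-adic `L`-function with a unit coefficient».  So MODULO PRINT AND SERRE UNIFORMITY
crux M is the one-signed Perrin-Riou `μ`-statement at three primes.  CONDITIONAL; closes nothing.
[cite: BalakrishnanEtAl2019, Cor. 1.3] [cite: BalakrishnanEtAl2023, Thm. 1.2] [cite: SerreKyoto1977, questions 6.5–6.6, pp. 187–188]
[cite: Kobayashi2003, Conjecture (Main Conjecture) (p. 2)] [cite: Pollack2003, Conj. 6.3 (p. 548)] -/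
theorem smallImageMuZeroOneSign_of_facts_of_muAnOneSign_le_eleven_of_nonsplitCartanPointsAreCM
    (hCK : thm62_63_73_signedColemanKato_zeta) (h12 : thm12_signedSelmerDual_finite_torsion)
    (h5 : realPeriodRat_eq_unit_mul_plusPeriod) (h3 : realPeriodRat_eq_unit_mul_plusPeriod_three)
    (hmodP : nonempty_modularParametrizationData)
    (h13 : Literature.NumberTheory.SerreUniformity.BDMTV2019_nonsplitCartan_level13)
    (h17 : Literature.NumberTheory.SerreUniformity.BDMTV2023_nonsplitCartan_level17)
    (h19 : ∀ (q : ℕ), q.Prime → 19 ≤ q → Literature.NumberTheory.SerreUniformity.NonsplitCartanPointsAreCM q)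
    (h5711 : ∀ (W : WeierstrassCurve ℚ) [W.IsElliptic] [W.IsGloballyMinimal] (p : ℕ) [Fact p.Prime],
      5 ≤ p → p ≤ 11 → Rank1Residual.ClassX7 W p → ¬ W.HasCM → W.frobeniusTrace p = 0 → ¬ Rank1Residual.Surj W p →
      ∀ [NeZero (W.conductorNorm ℤ)] (f : CuspForm (CongruenceSubgroup.Gamma0 (W.conductorNorm ℤ)) 2),
        IsNewformOf W f → ∃ (ε₀ : ℤˣ) (L₀ : IwasawaAlgebra p),
          IsSignedPAdicLFunction f p ε₀ L₀ ∧ GreenbergVatsal2000.HasUnitContent L₀) :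
    SmallImageMuZeroOneSign := by
  intro W _ _ p hpP hp hX hCM hap hs
  have hpr : p.Prime := hpP.out
  by_cases h11 : p ≤ 11
  · by_cases hp5 : 5 ≤ p
    · exact SmallImageMuControl.exists_sign_muZero_of_muAnOneSign_of_facts hCK h12 h5 h3 hmodP W p hp hX hCM hap hs
        (fun f hf ↦ h5711 W p hp5 h11 hX hCM hap hs f hf)
    · have h2 := hpr.two_le
      have hp3 : p = 3 := by
        interval_cases p
        · exact absurd rfl hp
        · rfl
        · exact absurd hpr (by decide)
      exact SmallImageMuControl.smallImageMuZeroOneSign_three_of_facts hCK h12 h5 h3 hmodP W p hp3 hX hCM hap hs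
  -- `12 ≤ p`: the domain is EMPTY once `X_ns⁺(p)(ℚ)` is CM (route-independent kernel of k3-c4's `…SmallImageCartan`:
  -- `hasNonsplitCartanModPImage_of_goodSS_of_not_surj`, Serre 1972 Prop. 12/14/17)
  have hempty : Literature.NumberTheory.SerreUniformity.NonsplitCartanPointsAreCM p → False := fun hU ↦
    hCM (hU W (Summit.BirchSwinnertonDyer.Rank1Residual.GaloisImage.hasNonsplitCartanModPImage_of_goodSS_of_not_surj
      W p hp hX.1 hs))
  by_cases h19p : 19 ≤ p
  · exact (hempty (h19 p hpr h19p)).elim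
  · have h1317 : p = 13 ∨ p = 17 := by
      interval_cases p <;> first | (left; rfl) | (right; rfl) | exact absurd hpr (by decide)
    rcases h1317 with rfl | rfl
    · exact (hempty h13).elim
    · exact (hempty h17).elim

/-! ## §3 (appended, width seat `bsd-line-slh-p3-w3` gen 2, director-bsd (323)(3)(a)) The open stub BY NAME ⟺ the {5, 7, 11} cut,
PRINT-FREE; and the input-free branch dichotomy on the cut's domain (`…SmallImageMuZeroOneSignEvenBranch`, route-independent). -/

/-- **Retired 23117 `SmallImageOneSignUnitContent` (= the registered stub `stub_muAnOneSignGeFive_ns` of line `birth_mu`, `Iff.rfl`)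
BY NAME ⟺ its `p ≤ 11` cut**, GRANTED BDMTV 2019 Cor. 1.3 / 2023 Thm. 1.2 (`h13`, `h17`, PUBLISHED, by name) and the non-split half
of Serre uniformity at every `p ≥ 19` (`h19`, OPEN).  Unlike §2 (the M-version) NO print (`hCK h12 h5 h3 hmodP`) is needed: at `13`,
`17`, `≥ 19` the stub's domain is empty.  (`SmallImageMuAnEvenBranch.stub_iff_le_eleven` on the verbatim text, read by name.)
[cite: BalakrishnanEtAl2019, Cor. 1.3] [cite: BalakrishnanEtAl2023, Thm. 1.2] [cite: SerreKyoto1977, questions 6.5–6.6, pp. 187–188]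
[cite: Pollack2003, Conj. 6.3 (p. 548)] -/
theorem smallImageOneSignUnitContent_iff_le_eleven
    (h13 : Literature.NumberTheory.SerreUniformity.BDMTV2019_nonsplitCartan_level13)
    (h17 : Literature.NumberTheory.SerreUniformity.BDMTV2023_nonsplitCartan_level17)
    (h19 : ∀ (q : ℕ), q.Prime → 19 ≤ q → Literature.NumberTheory.SerreUniformity.NonsplitCartanPointsAreCM q) :
    SmallImageOneSignUnitContent ↔
      ∀ (W : WeierstrassCurve ℚ) [W.IsElliptic] [W.IsGloballyMinimal] (p : ℕ) [Fact p.Prime],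
        5 ≤ p → p ≤ 11 → Rank1Residual.ClassX7 W p → ¬ W.HasCM → W.frobeniusTrace p = 0 → ¬ Rank1Residual.Surj W p →
        ∀ [NeZero (W.conductorNorm ℤ)] (f : CuspForm (CongruenceSubgroup.Gamma0 (W.conductorNorm ℤ)) 2),
          IsNewformOf W f → ∃ (ε₀ : ℤˣ) (L₀ : IwasawaAlgebra p),
            IsSignedPAdicLFunction f p ε₀ L₀ ∧ GreenbergVatsal2000.HasUnitContent L₀ :=
  SmallImageMuAnEvenBranch.stub_iff_le_eleven h13 h17 h19

/-- **Crux M BY NAME ⟸ print ∧ BDMTV ∧ Serre uniformity ∧ «one unit `ω⁰` Teichmüller orbit sum per pair at `p ∈ {5, 7, 11}`»**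
(Conjecture-W shape: for the conductor-level newform `f` of every small-image X7 pair with `5 ≤ p ≤ 11`, SOME orbit sum `S_f(p, n, b)`,
`n ≥ 1`, `b` a unit, has `p`-adic norm `≥ 1` — decidable pair by pair by finitely many exact modular symbols).  §2 composed with
`SmallImageMuAnEvenBranch.cut_of_orbitUnit`.  CONDITIONAL; closes nothing.
[cite: MazurTateTeitelbaum1986Invent, §I.10 (10.1)] [cite: PollackWeston2011, Thm. 4.1 (1), Rem. 4.2] [cite: BalakrishnanEtAl2019, Cor. 1.3] -/
theorem smallImageMuZeroOneSign_of_facts_of_orbitUnit_le_eleven_of_nonsplitCartanPointsAreCM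
    (hCK : thm62_63_73_signedColemanKato_zeta) (h12 : thm12_signedSelmerDual_finite_torsion)
    (h5 : realPeriodRat_eq_unit_mul_plusPeriod) (h3 : realPeriodRat_eq_unit_mul_plusPeriod_three)
    (hmodP : nonempty_modularParametrizationData)
    (h13 : Literature.NumberTheory.SerreUniformity.BDMTV2019_nonsplitCartan_level13)
    (h17 : Literature.NumberTheory.SerreUniformity.BDMTV2023_nonsplitCartan_level17)
    (h19 : ∀ (q : ℕ), q.Prime → 19 ≤ q → Literature.NumberTheory.SerreUniformity.NonsplitCartanPointsAreCM q)
    (hW : ∀ (W : WeierstrassCurve ℚ) [W.IsElliptic] [W.IsGloballyMinimal] (p : ℕ) [Fact p.Prime],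
      5 ≤ p → p ≤ 11 → Rank1Residual.ClassX7 W p → ¬ W.HasCM → W.frobeniusTrace p = 0 → ¬ Rank1Residual.Surj W p →
      ∀ [NeZero (W.conductorNorm ℤ)] (f : CuspForm (CongruenceSubgroup.Gamma0 (W.conductorNorm ℤ)) 2), IsNewformOf W f →
        ∃ n : ℕ, 1 ≤ n ∧ ∃ b : (ZMod (p ^ n))ˣ,
          1 ≤ ‖((Rank1Residual.teichOrbitSum f p n (b : ZMod (p ^ n)) : ℚ) : ℚ_[p])‖) :
    SmallImageMuZeroOneSign :=
  smallImageMuZeroOneSign_of_facts_of_muAnOneSign_le_eleven_of_nonsplitCartanPointsAreCM hCK h12 h5 h3 hmodP h13 h17 h19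
    (SmallImageMuAnEvenBranch.cut_of_orbitUnit hW)

/-- **On the cut's domain the branch dichotomy holds UNCONDITIONALLY** (read on the route's own population): at every small-image
X7 pair with `5 ≤ p` and its conductor-level newform, EITHER 23117's conclusion holds at the pair OR a non-trivial even weight
`0 < i < p − 1` carries a unit weighted Teichmüller orbit sum (`SmallImageMuAnEvenBranch.cut_or_pos_even_branch`, input-free:
THEOREM B road + orthogonality over `μ_{p−1}(ℤ_p)`).  So, modulo print, BDMTV and Serre uniformity, crux M's open content is «no pair at
`p ∈ {5, 7, 11}` carries its unit orbit content on the non-trivial even branches only» (at `p = 5`: on `ω² = (5/·)` alone).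
[cite: MazurTateTeitelbaum1986Invent, §I.13] [cite: PollackWeston2011, Rem. 4.2] -/
theorem oneSignUnitContent_or_pos_even_branch (W : WeierstrassCurve ℚ) [W.IsElliptic] [W.IsGloballyMinimal] (p : ℕ)
    [Fact p.Prime] (hp5 : 5 ≤ p) (hX : Rank1Residual.ClassX7 W p) (hap : W.frobeniusTrace p = 0)
    [NeZero (W.conductorNorm ℤ)] (f : CuspForm (CongruenceSubgroup.Gamma0 (W.conductorNorm ℤ)) 2) (hf : IsNewformOf W f) :
    (∃ (ε₀ : ℤˣ) (L₀ : IwasawaAlgebra p), IsSignedPAdicLFunction f p ε₀ L₀ ∧ GreenbergVatsal2000.HasUnitContent L₀) ∨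
      ∃ (n : ℕ) (s : ZMod (p ^ n)) (i : ℕ), 0 < i ∧ i < p - 1 ∧ Even i ∧
        ‖∑ᶠ ξ : rootsOfUnity (torsionOrder p) ℤ_[p], (((ξ : ℤ_[p]ˣ) : ℤ_[p]) : ℚ_[p]) ^ i *
          ((ratPlusSymbol f ((((PadicInt.toZModPow (n + 1) ((ξ : ℤ_[p]ˣ) : ℤ_[p]) *
            (cyclotomicGenerator p : ZMod (p ^ (n + 1))) ^ s.val).val : ℕ) : ℚ) / (p : ℚ) ^ (n + 1)) : ℚ) : ℚ_[p])‖ = 1 :=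
  SmallImageMuAnEvenBranch.cut_or_pos_even_branch W p hp5 hX hap f hf

end Summit.BirchSwinnertonDyer.BirchSwinnertonDyer.Theorems.SmallImageMuZeroOneSignOfFacts

end
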